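import Summits.QuantumAdvantage.QuantumAdvantage.Theorems.CubicForrelationNearExactIsExactCubicFormHalves
import Summits.QuantumAdvantage.QuantumAdvantage.Theorems.CubicForrelationNearExactIsExactCubicFormThirdZero
import Summits.QuantumAdvantage.QuantumAdvantage.Theorems.CubicForrelationNearExactIsExactCubicFormCellsOne

/-!
# Crux `CubicForrelation.NearExactIsExact` (stmt-QuantumAdvantage-14043) — cell lemma L2 for a CELL with cubic form `s₀ ∧ ω_{2h}`

Certificate seat `b2b-cforr-cert` (gen 41).  HONEST FRAMING: kernel-checked assembly (standard axioms) of …CubicFormThirdZero (halves of a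
function on `1 + n` bits) and …CubicFormHalves (`tcl_halves_rank`, `tcl_halves_eight`): step (4) → (5) of the hyperplane-branch recipe of
HOME/b2b-cforr-cert-g41/LEAN-TOOLS-GEN41.md.  A cell `f` on `1 + n` bits whose third differences are those of `s₀ ∧ ω_{2h}`
(`ω(v,w) = Σᵢ v_{lo i} w_{hi i} + v_{hi i} w_{lo i}` on the last `n` coordinates — the output format of …CubicFormLightCoords `tlc_coords`)
has quadratic halves `f₀ = f(0,·)`, `f₁ = f(1,·)` whose base-point free forms `B₀, B₁` differ by `ω`, and `ω` has the unit-vector maximal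
frame of size `h`; hence (…CubicFormHalves) maximal frames of sizes `h₀ + h₁ ≥ h` and, on `1 + 8` bits with `h ≥ 3` and `#f < 160`,
`B₀ ≡ 0` or `B₁ ≡ 0` (E1280-HANDPROOFS App. A.4: `β_H ∈ {0, ω}`).  Nothing about `θ₁₂`; NOT summit progress.

* `tl2_second_const`: base-point freeness of second differences from vanishing third differences (no degree hypothesis).
* `tl2_omega_frame`: the unit vectors `e_{lo i}, e_{hi i}` are a maximal symplectic frame of `ω` (given with a defining equation `hω`).
* `tl2_cell_halves`: halves quadratic-type (vanishing third differences), forms `B₀ ⊕ B₁ = ω`.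
* `tl2_cell_eight`: on `1 + 8` bits, `3 ≤ h`, `#f < 160` ⇒ `B₀ ≡ 0 ∨ B₁ ≡ 0`.
* `tl2_cell_eight_lb`: on `1 + 8` bits, `1 ≤ h ≤ 4` ⇒ `#f ≥ 128 − 2^{7−h}` (every cell is at least as heavy as the light one).

References: L. E. Dickson (1901); F. J. MacWilliams, N. J. A. Sloane (1977) Ch. 15 §2.  Axioms: the standard three.
-/

set_option linter.dupNamespace false -- D-0017: single-problem summit ⇒ `QuantumAdvantage.QuantumAdvantage` by design

namespace Summit.QuantumAdvantage.QuantumAdvantage.Theorems.CubicForrelation.NearExactIsExact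

open Finset
open Literature.Computability.QuantumComplexity
open Literature.Computability.QuantumComplexity.BuzetChailloux (bxor zeroVec bxor_comm bxor_self bxor_zeroVec zeroVec_bxor
  bxor_bxor_cancel_left)

variable {n : ℕ}

/-- **Second differences are base-point free when third differences vanish.** [folklore] -/
theorem tl2_second_const (g : (Fin n → Bool) → Bool)
    (h3 : ∀ u v w x : Fin n → Bool, (((g x ^^ g (bxor x w)) ^^ (g (bxor x v) ^^ g (bxor (bxor x v) w))) ^^
        ((g (bxor x u) ^^ g (bxor (bxor x u) w)) ^^ (g (bxor (bxor x u) v) ^^ g (bxor (bxor (bxor x u) v) w)))) = false)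
    (v w x : Fin n → Bool) :
    ((g x ^^ g (bxor x w)) ^^ (g (bxor x v) ^^ g (bxor (bxor x v) w))) =
      ((g zeroVec ^^ g (bxor zeroVec w)) ^^ (g (bxor zeroVec v) ^^ g (bxor (bxor zeroVec v) w))) := by
  have e := h3 x v w zeroVec
  simp only [zeroVec_bxor] at e ⊢
  revert e
  cases g zeroVec <;> cases g w <;> cases g v <;> cases g (bxor v w) <;> cases g x <;> cases g (bxor x w) <;>
    cases g (bxor x v) <;> cases g (bxor (bxor x v) w) <;> decide

section Omega

variable (h : ℕ) (lo hi : Fin h → Fin n) (hlo : Function.Injective lo) (hhi : Function.Injective hi) (hlohi : ∀ i j, lo i ≠ hi j)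
  (ω : (Fin n → Bool) → (Fin n → Bool) → Bool)
  (hω : ∀ v w, ω v w = decide ((∑ i : Fin h, ((if v (lo i) = true then (1 : ZMod 2) else 0) * (if w (hi i) = true then (1 : ZMod 2) else 0) +
        (if v (hi i) = true then (1 : ZMod 2) else 0) * (if w (lo i) = true then (1 : ZMod 2) else 0))) = 1))
include hlo hhi hlohi hω

/-- **The standard frame of `ω_{2h}`.**  For `ω(v,w) = [Σᵢ v_{lo i} w_{hi i} + v_{hi i} w_{lo i} = 1]` (distinct coordinates `lo i, hi i`),
the unit vectors `bᵢ = e_{lo i}`, `cᵢ = e_{hi i}` form a MAXIMAL symplectic frame: `ω(bᵢ,cⱼ) = [i=j]`, `ω(bᵢ,bⱼ) = ω(cᵢ,cⱼ) = 0`, and `ω`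
vanishes on vectors `ω`-orthogonal to the frame (they vanish on all `lo`, `hi` coordinates). [folklore] -/
theorem tl2_omega_frame :
    (∀ i, ω (fun l => decide (l = lo i)) (fun l => decide (l = hi i)) = true) ∧
    (∀ i j, i ≠ j → ω (fun l => decide (l = lo i)) (fun l => decide (l = hi j)) = false) ∧
    (∀ i j, ω (fun l => decide (l = lo i)) (fun l => decide (l = lo j)) = false) ∧
    (∀ i j, ω (fun l => decide (l = hi i)) (fun l => decide (l = hi j)) = false) ∧
    (∀ x y, (∀ i, ω x (fun l => decide (l = lo i)) = false) → (∀ i, ω x (fun l => decide (l = hi i)) = false) →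
      (∀ i, ω y (fun l => decide (l = lo i)) = false) → (∀ i, ω y (fun l => decide (l = hi i)) = false) → ω x y = false) := by
  have hlolo : ∀ i j, decide (lo i = lo j) = decide (i = j) := fun i j => by
    by_cases hij : i = j
    · rw [hij]; simp
    · rw [decide_eq_false (fun e => hij (hlo e)), decide_eq_false hij]
  have hhihi : ∀ i j, decide (hi i = hi j) = decide (i = j) := fun i j => by
    by_cases hij : i = j
    · rw [hij]; simp
    · rw [decide_eq_false (fun e => hij (hhi e)), decide_eq_false hij]
  have hlh : ∀ i j, decide (lo i = hi j) = false := fun i j => decide_eq_false (hlohi i j)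
  have hhl : ∀ i j, decide (hi i = lo j) = false := fun i j => decide_eq_false (fun e => hlohi j i e.symm)
  -- `ω` against a unit vector reads a coordinate
  have hωlo : ∀ x i, ω x (fun l => decide (l = lo i)) = x (hi i) := by
    intro x i
    rw [hω]
    simp only [hhl, hlolo, decide_eq_true_eq]
    simp only [Bool.false_eq_true, if_false, mul_zero, zero_add, mul_ite, mul_one, sum_ite_eq', mem_univ, if_true]
    cases x (hi i) <;> decide
  have hωhi : ∀ x i, ω x (fun l => decide (l = hi i)) = x (lo i) := by
    intro x i
    rw [hω]
    simp only [hlh, hhihi, decide_eq_true_eq]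
    simp only [Bool.false_eq_true, if_false, mul_zero, add_zero, mul_ite, mul_one, sum_ite_eq', mem_univ, if_true]
    cases x (lo i) <;> decide
  refine ⟨fun i => ?_, fun i j hij => ?_, fun i j => ?_, fun i j => ?_, fun x y hxl hxh _ _ => ?_⟩
  · rw [hωhi]; simp
  · rw [hωhi]; exact decide_eq_false (fun e => hij (hlo e).symm)
  · rw [hωlo]; exact hhl j i
  · rw [hωhi]; exact hlh j i
  · have hx1 : ∀ i, x (hi i) = false := fun i => by rw [← hωlo x i]; exact hxl i
    have hx2 : ∀ i, x (lo i) = false := fun i => by rw [← hωhi x i]; exact hxh i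
    rw [hω]
    simp only [hx1, hx2]
    simp

end Omega

/-- **The halves of a cell with cubic form `s₀ ∧ ω`.**  Let `f` on `1 + n` bits have third differences
`T3 f (u,v,w) = u₀·ω(v,w) ⊕ v₀·ω(u,w) ⊕ w₀·ω(u,v)` where `ω` only reads the last `n` coordinates (`ω(u,v) = ω'(u∘succ, v∘succ)`).  Then the
halves `f_b(s) = f(b,s)` have vanishing third differences, and their second differences (at any base points) differ by `ω'`. [this work] -/
theorem tl2_cell_halves (f : (Fin (1 + n) → Bool) → Bool) (ω' : (Fin n → Bool) → (Fin n → Bool) → Bool)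
    (hT : ∀ u v w x : Fin (1 + n) → Bool,
      (((f x ^^ f (bxor x w)) ^^ (f (bxor x v) ^^ f (bxor (bxor x v) w))) ^^
          ((f (bxor x u) ^^ f (bxor (bxor x u) w)) ^^ (f (bxor (bxor x u) v) ^^ f (bxor (bxor (bxor x u) v) w)))) =
        (((u (Fin.castAdd n (0 : Fin 1)) && ω' (fun j => v (Fin.natAdd 1 j)) (fun j => w (Fin.natAdd 1 j))) ^^
            (v (Fin.castAdd n (0 : Fin 1)) && ω' (fun j => u (Fin.natAdd 1 j)) (fun j => w (Fin.natAdd 1 j)))) ^^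
          (w (Fin.castAdd n (0 : Fin 1)) && ω' (fun j => u (Fin.natAdd 1 j)) (fun j => v (Fin.natAdd 1 j))))) :
    let f₀ : (Fin n → Bool) → Bool := fun s => f (Fin.append ![false] s)
    let f₁ : (Fin n → Bool) → Bool := fun s => f (Fin.append ![true] s)
    (∀ (b : Bool) (u v w x : Fin n → Bool),
      ((((fun s => f (Fin.append ![b] s)) x ^^ (fun s => f (Fin.append ![b] s)) (bxor x w)) ^^
          ((fun s => f (Fin.append ![b] s)) (bxor x v) ^^ (fun s => f (Fin.append ![b] s)) (bxor (bxor x v) w))) ^^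
        (((fun s => f (Fin.append ![b] s)) (bxor x u) ^^ (fun s => f (Fin.append ![b] s)) (bxor (bxor x u) w)) ^^
          ((fun s => f (Fin.append ![b] s)) (bxor (bxor x u) v) ^^ (fun s => f (Fin.append ![b] s)) (bxor (bxor (bxor x u) v) w)))) =
        false) ∧
    (∀ v w x x' : Fin n → Bool,
      (((f₀ x ^^ f₀ (bxor x w)) ^^ (f₀ (bxor x v) ^^ f₀ (bxor (bxor x v) w))) ^^
        ((f₁ x' ^^ f₁ (bxor x' w)) ^^ (f₁ (bxor x' v) ^^ f₁ (bxor (bxor x' v) w)))) = ω' v w) := by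
  intro f₀ f₁
  have happ : ∀ (bb : Fin 1 → Bool) (s : Fin n → Bool) (j : Fin n), Fin.append bb s (Fin.natAdd 1 j) = s j :=
    fun bb s j => Fin.append_right bb s j
  have happ0 : ∀ (bb : Fin 1 → Bool) (s : Fin n → Bool), Fin.append bb s (Fin.castAdd n (0 : Fin 1)) = bb 0 :=
    fun bb s => Fin.append_left bb s 0
  -- vanishing third differences of the halves
  have h3 : ∀ (b : Bool) (u v w x : Fin n → Bool),
      ((((fun s => f (Fin.append ![b] s)) x ^^ (fun s => f (Fin.append ![b] s)) (bxor x w)) ^^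
          ((fun s => f (Fin.append ![b] s)) (bxor x v) ^^ (fun s => f (Fin.append ![b] s)) (bxor (bxor x v) w))) ^^
        (((fun s => f (Fin.append ![b] s)) (bxor x u) ^^ (fun s => f (Fin.append ![b] s)) (bxor (bxor x u) w)) ^^
          ((fun s => f (Fin.append ![b] s)) (bxor (bxor x u) v) ^^ (fun s => f (Fin.append ![b] s)) (bxor (bxor (bxor x u) v) w)))) =
        false := by
    intro b u v w x
    have e := tcz_half_third f ![b] u v w x
    simp only at e
    rw [e, hT]
    simp only [happ, happ0, zeroVec, Bool.false_and, Bool.xor_false]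
  refine ⟨h3, fun v w x x' => ?_⟩
  -- forms differ by `ω'`: move both to the base point `0`, then the 16-term identity at `(0, 0)`
  have h30 := h3 false
  have h31 := h3 true
  simp only at h30 h31
  rw [tl2_second_const f₀ h30 v w x, tl2_second_const f₁ h31 v w x']
  have e := tcz_halves_forms f v w zeroVec
  simp only at e
  rw [e, hT]
  have h1 : (![true] : Fin 1 → Bool) 0 = true := rfl
  simp only [happ, happ0, zeroVec, Bool.false_and, Bool.xor_false, h1, Bool.true_and]

/-- **Cell lemma L2 on `1 + 8` bits** (E1280-HANDPROOFS App. A.4, `μ ≥ 3`): a cell `f` with cubic form `s₀ ∧ ω_{2h}`, `h ≥ 3`, and fewer than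
`160` ones has halves whose base-point free forms satisfy `B₀ ≡ 0` or `B₁ ≡ 0` — the `H × H` block of its alternating part is `0` or `ω`.
[this work; cite: MacWilliamsSloane1977, Ch. 15 §2] -/
theorem tl2_cell_eight (f : (Fin (1 + 8) → Bool) → Bool) (h : ℕ) (hh : 3 ≤ h) (lo hi : Fin h → Fin 8)
    (hlo : Function.Injective lo) (hhi : Function.Injective hi) (hlohi : ∀ i j, lo i ≠ hi j)
    (ω' : (Fin 8 → Bool) → (Fin 8 → Bool) → Bool)
    (hω' : ∀ v w, ω' v w = decide ((∑ i : Fin h, ((if v (lo i) = true then (1 : ZMod 2) else 0) * (if w (hi i) = true then (1 : ZMod 2) else 0) +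
        (if v (hi i) = true then (1 : ZMod 2) else 0) * (if w (lo i) = true then (1 : ZMod 2) else 0))) = 1))
    (hT : ∀ u v w x : Fin (1 + 8) → Bool,
      (((f x ^^ f (bxor x w)) ^^ (f (bxor x v) ^^ f (bxor (bxor x v) w))) ^^
          ((f (bxor x u) ^^ f (bxor (bxor x u) w)) ^^ (f (bxor (bxor x u) v) ^^ f (bxor (bxor (bxor x u) v) w)))) =
        (((u (Fin.castAdd 8 (0 : Fin 1)) && ω' (fun j => v (Fin.natAdd 1 j)) (fun j => w (Fin.natAdd 1 j))) ^^
            (v (Fin.castAdd 8 (0 : Fin 1)) && ω' (fun j => u (Fin.natAdd 1 j)) (fun j => w (Fin.natAdd 1 j)))) ^^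
          (w (Fin.castAdd 8 (0 : Fin 1)) && ω' (fun j => u (Fin.natAdd 1 j)) (fun j => v (Fin.natAdd 1 j)))))
    (hlt : #(univ.filter fun y : Fin (1 + 8) → Bool => f y = true) < 160) :
    let f₀ : (Fin 8 → Bool) → Bool := fun s => f (Fin.append ![false] s)
    let f₁ : (Fin 8 → Bool) → Bool := fun s => f (Fin.append ![true] s)
    (∀ v w x, ((f₀ x ^^ f₀ (bxor x w)) ^^ (f₀ (bxor x v) ^^ f₀ (bxor (bxor x v) w))) = false) ∨
    (∀ v w x, ((f₁ x ^^ f₁ (bxor x w)) ^^ (f₁ (bxor x v) ^^ f₁ (bxor (bxor x v) w))) = false) := by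
  intro f₀ f₁
  obtain ⟨h3, hforms⟩ := tl2_cell_halves f ω' hT
  have h30 := h3 false
  have h31 := h3 true
  simp only at h30 h31
  -- the base-point free forms (as opaque functions with defining equations)
  obtain ⟨B₀, hB₀⟩ : ∃ B₀ : (Fin 8 → Bool) → (Fin 8 → Bool) → Bool,
      ∀ v w, B₀ v w = ((f₀ zeroVec ^^ f₀ (bxor zeroVec w)) ^^ (f₀ (bxor zeroVec v) ^^ f₀ (bxor (bxor zeroVec v) w))) :=
    ⟨_, fun v w => rfl⟩
  obtain ⟨B₁, hB₁⟩ : ∃ B₁ : (Fin 8 → Bool) → (Fin 8 → Bool) → Bool,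
      ∀ v w, B₁ v w = ((f₁ zeroVec ^^ f₁ (bxor zeroVec w)) ^^ (f₁ (bxor zeroVec v) ^^ f₁ (bxor (bxor zeroVec v) w))) :=
    ⟨_, fun v w => rfl⟩
  have hB₀' : ∀ v w x, ((f₀ x ^^ f₀ (bxor x w)) ^^ (f₀ (bxor x v) ^^ f₀ (bxor (bxor x v) w))) = B₀ v w :=
    fun v w x => by rw [hB₀]; exact tl2_second_const f₀ h30 v w x
  have hB₁' : ∀ v w x, ((f₁ x ^^ f₁ (bxor x w)) ^^ (f₁ (bxor x v) ^^ f₁ (bxor (bxor x v) w))) = B₁ v w :=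
    fun v w x => by rw [hB₁]; exact tl2_second_const f₁ h31 v w x
  have hω : ∀ v w, (B₀ v w ^^ B₁ v w) = ω' v w := fun v w => by
    rw [← hB₀' v w zeroVec, ← hB₁' v w zeroVec]; exact hforms v w zeroVec zeroVec
  -- the standard frame of `ω'`, transported to `B₀ ⊕ B₁`
  obtain ⟨o1, o2, o3, o4, omax⟩ := tl2_omega_frame h lo hi hlo hhi hlohi ω' hω'
  have hcard : #(univ.filter fun x : Fin 8 → Bool => f₀ x = true) + #(univ.filter fun x : Fin 8 → Bool => f₁ x = true) < 160 := by
    rw [← tco_card_halves]; exact hlt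
  rcases tcl_halves_eight f₀ f₁ B₀ B₁ hB₀' hB₁' h hh (fun i => fun l => decide (l = lo i)) (fun i => fun l => decide (l = hi i))
      (fun i => by rw [hω]; exact o1 i) (fun i j hij => by rw [hω]; exact o2 i j hij) (fun i j => by rw [hω]; exact o3 i j)
      (fun x y h1 h2 h3' h4 => by
        rw [hω]
        exact omax x y (fun i => by rw [← hω]; exact h1 i) (fun i => by rw [← hω]; exact h2 i) (fun i => by rw [← hω]; exact h3' i)
          (fun i => by rw [← hω]; exact h4 i))
      hcard with hz | hz
  · left; intro v w x; rw [hB₀']; exact hz v w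
  · right; intro v w x; rw [hB₁']; exact hz v w

/-- **Weight lower bound for a cell with cubic form `s₀ ∧ ω_{2h}` on `1 + 8` bits**: `#f ≥ 128 − 2^{7−h}` (`1 ≤ h ≤ 4`).  With the cell
weights summing to `< 384` (E1280) this is what makes the OTHER cells light enough for `tl2_cell_eight` (E1280-HANDPROOFS App. A.4).
[this work; cite: MacWilliamsSloane1977, Ch. 15 §2] -/
theorem tl2_cell_eight_lb (f : (Fin (1 + 8) → Bool) → Bool) (h : ℕ) (hh1 : 1 ≤ h) (hh4 : h ≤ 4) (lo hi : Fin h → Fin 8)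
    (hlo : Function.Injective lo) (hhi : Function.Injective hi) (hlohi : ∀ i j, lo i ≠ hi j)
    (ω' : (Fin 8 → Bool) → (Fin 8 → Bool) → Bool)
    (hω' : ∀ v w, ω' v w = decide ((∑ i : Fin h, ((if v (lo i) = true then (1 : ZMod 2) else 0) * (if w (hi i) = true then (1 : ZMod 2) else 0) +
        (if v (hi i) = true then (1 : ZMod 2) else 0) * (if w (lo i) = true then (1 : ZMod 2) else 0))) = 1))
    (hT : ∀ u v w x : Fin (1 + 8) → Bool,
      (((f x ^^ f (bxor x w)) ^^ (f (bxor x v) ^^ f (bxor (bxor x v) w))) ^^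
          ((f (bxor x u) ^^ f (bxor (bxor x u) w)) ^^ (f (bxor (bxor x u) v) ^^ f (bxor (bxor (bxor x u) v) w)))) =
        (((u (Fin.castAdd 8 (0 : Fin 1)) && ω' (fun j => v (Fin.natAdd 1 j)) (fun j => w (Fin.natAdd 1 j))) ^^
            (v (Fin.castAdd 8 (0 : Fin 1)) && ω' (fun j => u (Fin.natAdd 1 j)) (fun j => w (Fin.natAdd 1 j)))) ^^
          (w (Fin.castAdd 8 (0 : Fin 1)) && ω' (fun j => u (Fin.natAdd 1 j)) (fun j => v (Fin.natAdd 1 j))))) :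
    128 ≤ #(univ.filter fun y : Fin (1 + 8) → Bool => f y = true) + 2 ^ (7 - h) := by
  obtain ⟨h3, hforms⟩ := tl2_cell_halves f ω' hT
  have h30 := h3 false
  have h31 := h3 true
  simp only at h30 h31
  set f₀ : (Fin 8 → Bool) → Bool := fun s => f (Fin.append ![false] s) with hf₀
  set f₁ : (Fin 8 → Bool) → Bool := fun s => f (Fin.append ![true] s) with hf₁
  obtain ⟨B₀, hB₀⟩ : ∃ B₀ : (Fin 8 → Bool) → (Fin 8 → Bool) → Bool,
      ∀ v w, B₀ v w = ((f₀ zeroVec ^^ f₀ (bxor zeroVec w)) ^^ (f₀ (bxor zeroVec v) ^^ f₀ (bxor (bxor zeroVec v) w))) :=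
    ⟨_, fun v w => rfl⟩
  obtain ⟨B₁, hB₁⟩ : ∃ B₁ : (Fin 8 → Bool) → (Fin 8 → Bool) → Bool,
      ∀ v w, B₁ v w = ((f₁ zeroVec ^^ f₁ (bxor zeroVec w)) ^^ (f₁ (bxor zeroVec v) ^^ f₁ (bxor (bxor zeroVec v) w))) :=
    ⟨_, fun v w => rfl⟩
  have hB₀' : ∀ v w x, ((f₀ x ^^ f₀ (bxor x w)) ^^ (f₀ (bxor x v) ^^ f₀ (bxor (bxor x v) w))) = B₀ v w :=
    fun v w x => by rw [hB₀]; exact tl2_second_const f₀ h30 v w x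
  have hB₁' : ∀ v w x, ((f₁ x ^^ f₁ (bxor x w)) ^^ (f₁ (bxor x v) ^^ f₁ (bxor (bxor x v) w))) = B₁ v w :=
    fun v w x => by rw [hB₁]; exact tl2_second_const f₁ h31 v w x
  have hω : ∀ v w, (B₀ v w ^^ B₁ v w) = ω' v w := fun v w => by
    rw [← hB₀' v w zeroVec, ← hB₁' v w zeroVec]; exact hforms v w zeroVec zeroVec
  obtain ⟨o1, o2, o3, o4, omax⟩ := tl2_omega_frame h lo hi hlo hhi hlohi ω' hω'
  obtain ⟨h₀, h₁, b₀, c₀, b₁, c₁, -, -, hsub, hle₀, hle₁, hD₀, hD₁⟩ :=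
    tcl_halves_rank f₀ f₁ B₀ B₁ hB₀' hB₁' h (fun i => fun l => decide (l = lo i)) (fun i => fun l => decide (l = hi i))
      (fun i => by rw [hω]; exact o1 i) (fun i j hij => by rw [hω]; exact o2 i j hij) (fun i j => by rw [hω]; exact o3 i j)
      (fun x y h1 h2 h3' h4 => by
        rw [hω]
        exact omax x y (fun i => by rw [← hω]; exact h1 i) (fun i => by rw [← hω]; exact h2 i) (fun i => by rw [← hω]; exact h3' i)
          (fun i => by rw [← hω]; exact h4 i))
  rw [tco_card_halves]
  change 128 ≤ #(univ.filter fun x : Fin 8 → Bool => f₀ x = true) + #(univ.filter fun x : Fin 8 → Bool => f₁ x = true) + 2 ^ (7 - h)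
  have hh₀ : h₀ ≤ 4 := by omega
  have hh₁ : h₁ ≤ 4 := by omega
  interval_cases h <;> interval_cases h₀ <;> interval_cases h₁ <;> simp only [Nat.reducePow, Nat.reduceSub] at hD₀ hD₁ ⊢ <;> omega

end Summit.QuantumAdvantage.QuantumAdvantage.Theorems.CubicForrelation.NearExactIsExact
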